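import Summits.BirchSwinnertonDyer.BirchSwinnertonDyer.Theorems.ByReductionTypeAtTwoTowerLayerUniversalDoors
import Literature.NumberTheory.EllipticCurves.Greenberg1999.ControlLocalKernelsLayerMultiplicativeProofs
import HarnessLib

/-!
# The TOWER doors with `h33g`, `hA` AND `hM` DISCHARGED: the only local PRINT binder left is `hS34`
# (route ByReductionTypeAtTwo, crux `OrdKatoHalfAtTwo`, item stmt-BirchSwinnertonDyer-19271;
# seat bsd-2adic-tower-1 GEN 4, part 15)

HONEST FRAMING (cell `bsd-2adic`, run/shared/lean/pub/bsd-2adic/, HUMAN RULINGS D-0036/D-0074): THEOREMS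
ONLY; nothing asserted; no definition; no new named fact; closes nothing by itself.

Parts 14a/14b (`…TowerLayerUniversal`, `…TowerLayerUniversalDoors`, GEN 3) display the local PRINT binders
`hM` (Greenberg, LNM 1716, §3 p. 88: multiplicative `v ∤ 2`, every layer) and `hS34` (Lemma 3.4
structure at `2`). `hM` is now a THEOREM of the tree (this seat, GEN 4):
`Greenberg1999.lemma33_localTowerKerPrimary_cyclic_of_multiplicative_holds`
(`Literature/NumberTheory/EllipticCurves/Greenberg1999/ControlLocalKernelsLayerMultiplicativeProofs`; via the
inertia inflation–restriction `…InertiaCyclicProofs`, the PROVED twisted Tate uniformisation with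
`v(q) = v(j)⁻¹` `TateCurve/NumberFieldUniformizationTwistedValuation`, the unramifiedness of the twist
`TateCurve/MultiplicativeTwistUnramifiedProofs`, and the value group of `K_v^nr`). This file re-derives
the chain numeric → nat → cert → doors with `hS34` as the ONLY local PRINT binder (suffix `M` = "`hM`
discharged"; every other binder identical to the `_univ` version, same order):

* `towerGapAtTwo_of_layerSelmer_numeric_univM` / `_nat_univM` / `_cert_univM` / `_cert_upper_univM` —
  the GAP certificate `O1.TowerGapAtTwo W`;
* doors: `katoHalfAt_two_of_layerSelmer_cert_gap_univM` / `_upper_gap_univM` (the item `OrdKatoHalfAtTwo`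
  AT `W`, any analytic rank; PRINT `h17`, `hS34`), `bsdp_two_of_layerSelmer_cert_univM_of_missingLowerBoundAt`,
  `mazurMainConjecture_two_of_layerSelmer_cert_univM_of_missingLowerBoundAt` (rank `0`, `Ш`-currency;
  PRINT `hmod`, `hGZK`, `h17`, `hEC`, `hS34`).

CERTIFICATE binders unchanged (`hper₀`, odd torsion, `P/hP/hΔ`, `C/e/k` with `he/hC`, layer Selmer
count(s), closed arithmetic, `MissingLowerBoundAt W 2` for `BSDp`). With `h33g`, `hA`, `hM` all
discharged, the odd-place side of the gap certificate is PRINT-FREE: the sharp constants `C_ℓ = 1`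
(good, or multiplicative with `2 ∤ ord_ℓ Δ_min`), `C_ℓ = 2` (multiplicative), `C_ℓ = 4` (any) are all
kernel theorems.

References: R. Greenberg, LNM 1716 (1999), §3 Lemmas 3.3–3.5 (PDF pp. 86–90), Prop. 2.5, Thm. 4.1;
K. Kato, Astérisque 295 (2004), Thm. 17.4; J. H. Silverman, AEC VII.1, VII.5; ATAEC V.5.3.
-/

set_option autoImplicit false

noncomputable section

open scoped Classical MatrixGroups ModularForm

open NumberField IsDedekindDomain CongruenceSubgroup WeierstrassCurve Literature.NumberTheory.EllipticCurves
  Literature.NumberTheory.EllipticCurves.ModularForms Literature.NumberTheory.EllipticCurves.Rank1Residual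
  Literature.NumberTheory.EllipticCurves.Rank1Residual.Typed
  Literature.NumberTheory.EllipticCurves.Greenberg1999
  Literature.NumberTheory.GaloisRepresentations
  Summit.BirchSwinnertonDyer.Rank1Residual.X1.MuLambda
  Summit.BirchSwinnertonDyer.Rank1Residual.X1.MuPart
  Summit.BirchSwinnertonDyer.Rank1Residual.X1.ParitySqueeze
  Summit.BirchSwinnertonDyer.BirchSwinnertonDyer.Theorems.Rank1ResidualX1Defs
  Summit.BirchSwinnertonDyer.Rank1Residual.X5 Summit.BirchSwinnertonDyer.Rank1Residual.X5.O1
  Summit.BirchSwinnertonDyer.Rank1Residual.X5.TowerGap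
  Summit.BirchSwinnertonDyer.Rank1Residual
  Rat.HeightOneSpectrum

namespace Summit.BirchSwinnertonDyer.BirchSwinnertonDyer.Theorems.KatoHalfPinch

section Curve

variable (W : WeierstrassCurve ℚ) [W.IsElliptic] [W.IsGloballyMinimal]

/-! ### The GAP certificate, `hM` discharged -/

/-- **The GAP certificate from a NUMERIC local table, `h33g`/`hA`/`hM` discharged** (as
`towerGapAtTwo_of_layerSelmer_numeric_univ` with `hM := lemma33_localTowerKerPrimary_cyclic_of_multiplicative_holds`):
PRINT `hS34` only; CERTIFICATES: two layer Selmer counts, numeric `C_v` per odd `v ∈ S` justified by ONE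
disjunct of `hC`, closed arithmetic. Then `O1.TowerGapAtTwo W`.
[cite: GreenbergLNM1716, §3 Lemmas 3.3–3.5 (PDF pp. 86–90), Prop. 2.5] [cite: Washington1997, §13.1] -/
theorem towerGapAtTwo_of_layerSelmer_numeric_univM
    (hS34 : lemma34_localTowerKerPrimary_cyclicExtension_rat)
    (hgo : GoodOrd W 2) (htors : ¬ 2 ∣ W.torsionOrder) {j j' a d : ℕ} (hjj' : j ≤ j')
    (S : Finset (HeightOneSpectrum (𝓞 ℚ)))
    (hS : ∀ v ∉ S, ((2 : ℕ) : 𝓞 ℚ) ∉ v.asIdeal ∧ W.HasGoodReductionAt v)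
    (C : HeightOneSpectrum (𝓞 ℚ) → ℕ)
    (hC : ∀ v ∈ S, ((2 : ℕ) : 𝓞 ℚ) ∉ v.asIdeal →
      4 ≤ C v ∨ (W.HasMultiplicativeReductionAt v ∧ 2 ≤ C v) ∨
        (W.HasMultiplicativeReductionAt v ∧ ¬ 2 ∣ W.ordMinimalDiscriminant v ∧ 1 ≤ C v) ∨
        (W.HasGoodReductionAt v ∧ 1 ≤ C v))
    (hlow : ∀ κ : ZpExtension ℚ 2, κ.IsCyclotomic →
      2 ^ a ≤ Nat.card {z : W.selmerLayer κ j // 2 • z = 0})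
    (hup : ∀ κ : ZpExtension ℚ 2, κ.IsCyclotomic →
      Nat.card {z : W.selmerLayer κ j' // 2 • z = 0} ≤ 2 ^ d)
    (harith : 2 ^ d * ∏ v ∈ S, (if ((2 : ℕ) : 𝓞 ℚ) ∈ v.asIdeal then 4 else C v) ^
        (if ((2 : ℕ) : 𝓞 ℚ) ∈ v.asIdeal then 1
          else 2 ^ min j' (padicValNat 2 (Rat.HeightOneSpectrum.natGenerator v ^ 2 - 1) - 3)) <
      2 ^ (2 ^ j' - 2 ^ j + a)) : TowerGapAtTwo W :=
  towerGapAtTwo_of_layerSelmer_numeric_univ W lemma33_localTowerKerPrimary_cyclic_of_multiplicative_holds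
    hS34 hgo htors hjj' S hS C hC hlow hup harith

/-- **The GAP certificate indexed by rational primes, `h33g`/`hA`/`hM` discharged** (as
`towerGapAtTwo_of_layerSelmer_nat_univ`). PRINT `hS34` only.
[cite: GreenbergLNM1716, §3 Lemmas 3.3–3.5 (PDF pp. 86–90), Prop. 2.5] [cite: SilvermanAEC2009, VII.1 Prop. 1.3, VII.5.1] -/
theorem towerGapAtTwo_of_layerSelmer_nat_univM
    (hS34 : lemma34_localTowerKerPrimary_cyclicExtension_rat)
    (hgo : GoodOrd W 2) (htors : ¬ 2 ∣ W.torsionOrder) {j j' a d : ℕ} (hjj' : j ≤ j')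
    (P : Finset ℕ) (hP : ∀ ℓ ∈ P, ℓ.Prime ∧ ℓ ≠ 2)
    (hΔ : ∀ ℓ : ℕ, ℓ.Prime → ℓ ≠ 2 → (ℓ : ℤ) ∣ W.minimalDiscriminantInt → ℓ ∈ P)
    (C : ℕ → ℕ)
    (hC : ∀ (ℓ : ℕ) [Fact ℓ.Prime], ℓ ∈ P →
      4 ≤ C ℓ ∨ (W.HasMultiplicativeReductionAtPrime ℓ ∧ 2 ≤ C ℓ) ∨
        (W.HasMultiplicativeReductionAtPrime ℓ ∧ ¬ 2 ∣ padicValInt ℓ W.minimalDiscriminantInt ∧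
          1 ≤ C ℓ) ∨
        (¬ (ℓ : ℤ) ∣ W.minimalDiscriminantInt ∧ 1 ≤ C ℓ))
    (hlow : ∀ κ : ZpExtension ℚ 2, κ.IsCyclotomic →
      2 ^ a ≤ Nat.card {z : W.selmerLayer κ j // 2 • z = 0})
    (hup : ∀ κ : ZpExtension ℚ 2, κ.IsCyclotomic →
      Nat.card {z : W.selmerLayer κ j' // 2 • z = 0} ≤ 2 ^ d)
    (harith : 2 ^ d * 4 * ∏ ℓ ∈ P, C ℓ ^ 2 ^ min j' (padicValNat 2 (ℓ ^ 2 - 1) - 3) <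
      2 ^ (2 ^ j' - 2 ^ j + a)) : TowerGapAtTwo W :=
  towerGapAtTwo_of_layerSelmer_nat_univ W lemma33_localTowerKerPrimary_cyclic_of_multiplicative_holds
    hS34 hgo htors hjj' P hP hΔ C hC hlow hup harith

/-- **The GAP certificate, every kernel-side datum decidable, PRINT only `hS34`** (as
`towerGapAtTwo_of_layerSelmer_cert_univ`, `hM` discharged).
[cite: GreenbergLNM1716, §3 Lemmas 3.3–3.5 (PDF pp. 86–90), Prop. 2.5] [cite: SilvermanAEC2009, VII.1 Prop. 1.3, VII.5.1] -/
theorem towerGapAtTwo_of_layerSelmer_cert_univM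
    (hS34 : lemma34_localTowerKerPrimary_cyclicExtension_rat)
    (hgo : GoodOrd W 2) (htors : ¬ 2 ∣ W.torsionOrder) {j j' a d : ℕ} (hjj' : j ≤ j')
    (P : Finset ℕ) (hP : ∀ ℓ ∈ P, ℓ.Prime ∧ ℓ ≠ 2)
    (hΔ : ∀ ℓ : ℕ, ℓ.Prime → ℓ ≠ 2 → (ℓ : ℤ) ∣ W.minimalDiscriminantInt → ℓ ∈ P)
    (C e k : ℕ → ℕ) (he : ∀ ℓ ∈ P, ¬ 2 ^ (e ℓ + 4) ∣ ℓ ^ 2 - 1)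
    (hC : ∀ (ℓ : ℕ) [Fact ℓ.Prime], ℓ ∈ P →
      4 ≤ C ℓ ∨ (W.HasMultiplicativeReductionAtPrime ℓ ∧ 2 ≤ C ℓ) ∨
        (W.HasMultiplicativeReductionAtPrime ℓ ∧ (ℓ : ℤ) ^ k ℓ ∣ W.minimalDiscriminantInt ∧
          ¬ (ℓ : ℤ) ^ (k ℓ + 1) ∣ W.minimalDiscriminantInt ∧ ¬ 2 ∣ k ℓ ∧ 1 ≤ C ℓ) ∨
        (¬ (ℓ : ℤ) ∣ W.minimalDiscriminantInt ∧ 1 ≤ C ℓ))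
    (hlow : ∀ κ : ZpExtension ℚ 2, κ.IsCyclotomic →
      2 ^ a ≤ Nat.card {z : W.selmerLayer κ j // 2 • z = 0})
    (hup : ∀ κ : ZpExtension ℚ 2, κ.IsCyclotomic →
      Nat.card {z : W.selmerLayer κ j' // 2 • z = 0} ≤ 2 ^ d)
    (harith : 2 ^ d * 4 * ∏ ℓ ∈ P, C ℓ ^ 2 ^ min j' (e ℓ) < 2 ^ (2 ^ j' - 2 ^ j + a)) :
    TowerGapAtTwo W :=
  towerGapAtTwo_of_layerSelmer_cert_univ W lemma33_localTowerKerPrimary_cyclic_of_multiplicative_holds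
    hS34 hgo htors hjj' P hP hΔ C e k he hC hlow hup harith

/-- **The GAP certificate from ONE layer count, PRINT only `hS34`** (as
`towerGapAtTwo_of_layerSelmer_cert_upper_univ`, `hM` discharged).
[cite: GreenbergLNM1716, §3 Lemmas 3.1, 3.3–3.5, Prop. 2.5] [cite: SilvermanAEC2009, VII.1 Prop. 1.3, VII.5.1] -/
theorem towerGapAtTwo_of_layerSelmer_cert_upper_univM
    (hS34 : lemma34_localTowerKerPrimary_cyclicExtension_rat)
    (hgo : GoodOrd W 2) (htors : ¬ 2 ∣ W.torsionOrder) {j' d : ℕ}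
    (P : Finset ℕ) (hP : ∀ ℓ ∈ P, ℓ.Prime ∧ ℓ ≠ 2)
    (hΔ : ∀ ℓ : ℕ, ℓ.Prime → ℓ ≠ 2 → (ℓ : ℤ) ∣ W.minimalDiscriminantInt → ℓ ∈ P)
    (C e k : ℕ → ℕ) (he : ∀ ℓ ∈ P, ¬ 2 ^ (e ℓ + 4) ∣ ℓ ^ 2 - 1)
    (hC : ∀ (ℓ : ℕ) [Fact ℓ.Prime], ℓ ∈ P →
      4 ≤ C ℓ ∨ (W.HasMultiplicativeReductionAtPrime ℓ ∧ 2 ≤ C ℓ) ∨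
        (W.HasMultiplicativeReductionAtPrime ℓ ∧ (ℓ : ℤ) ^ k ℓ ∣ W.minimalDiscriminantInt ∧
          ¬ (ℓ : ℤ) ^ (k ℓ + 1) ∣ W.minimalDiscriminantInt ∧ ¬ 2 ∣ k ℓ ∧ 1 ≤ C ℓ) ∨
        (¬ (ℓ : ℤ) ∣ W.minimalDiscriminantInt ∧ 1 ≤ C ℓ))
    (hup : ∀ κ : ZpExtension ℚ 2, κ.IsCyclotomic →
      Nat.card {z : W.selmerLayer κ j' // 2 • z = 0} ≤ 2 ^ d)
    (harith : 2 ^ d * 4 * ∏ ℓ ∈ P, C ℓ ^ 2 ^ min j' (e ℓ) < 2 ^ (2 ^ j' - 1)) :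
    TowerGapAtTwo W :=
  towerGapAtTwo_of_layerSelmer_cert_upper_univ W
    lemma33_localTowerKerPrimary_cyclic_of_multiplicative_holds hS34 hgo htors P hP hΔ C e k he hC hup
    harith

/-! ### Doors, `hM` discharged -/

/-- **The item `OrdKatoHalfAtTwo` AT `W` from the GAP certificate alone (two layer counts), `h33g`, `hA`
AND `hM` discharged.** PRINT: `h17`, `hS34`; CERTIFICATES as in `katoHalfAt_two_of_layerSelmer_cert_gap`.
Any analytic rank. [cite: Kato2004Asterisque, Thm. 17.4 (1)(2) (p. 273)]
[cite: GreenbergLNM1716, §3 Lemmas 3.3–3.5 (PDF pp. 86–90), Prop. 2.5] -/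
theorem katoHalfAt_two_of_layerSelmer_cert_gap_univM
    (h17 : ∀ [NeZero (W.conductorNorm ℤ)] (f : CuspForm (Gamma0 (W.conductorNorm ℤ)) 2),
      kato_divisibility_allPrimes W 2 (f := f))
    (hS34 : lemma34_localTowerKerPrimary_cyclicExtension_rat)
    (hper₀ : ∀ [NeZero (W.conductorNorm ℤ)] (f : CuspForm (Gamma0 (W.conductorNorm ℤ)) 2),
      IsNewformOf W f → ∀ ϖ : ℚ, (ϖ : ℝ) * W.realPeriodRat = plusPeriod f → 0 ≤ padicValRat 2 ϖ)
    (hgo : GoodOrd W 2) (htors : ¬ 2 ∣ W.torsionOrder) {j j' a d : ℕ} (hjj' : j ≤ j')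
    (P : Finset ℕ) (hP : ∀ ℓ ∈ P, ℓ.Prime ∧ ℓ ≠ 2)
    (hΔ : ∀ ℓ : ℕ, ℓ.Prime → ℓ ≠ 2 → (ℓ : ℤ) ∣ W.minimalDiscriminantInt → ℓ ∈ P)
    (C e k : ℕ → ℕ) (he : ∀ ℓ ∈ P, ¬ 2 ^ (e ℓ + 4) ∣ ℓ ^ 2 - 1)
    (hC : ∀ (ℓ : ℕ) [Fact ℓ.Prime], ℓ ∈ P →
      4 ≤ C ℓ ∨ (W.HasMultiplicativeReductionAtPrime ℓ ∧ 2 ≤ C ℓ) ∨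
        (W.HasMultiplicativeReductionAtPrime ℓ ∧ (ℓ : ℤ) ^ k ℓ ∣ W.minimalDiscriminantInt ∧
          ¬ (ℓ : ℤ) ^ (k ℓ + 1) ∣ W.minimalDiscriminantInt ∧ ¬ 2 ∣ k ℓ ∧ 1 ≤ C ℓ) ∨
        (¬ (ℓ : ℤ) ∣ W.minimalDiscriminantInt ∧ 1 ≤ C ℓ))
    (hlow : ∀ κ : ZpExtension ℚ 2, κ.IsCyclotomic →
      2 ^ a ≤ Nat.card {z : W.selmerLayer κ j // 2 • z = 0})
    (hup : ∀ κ : ZpExtension ℚ 2, κ.IsCyclotomic →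
      Nat.card {z : W.selmerLayer κ j' // 2 • z = 0} ≤ 2 ^ d)
    (harith : 2 ^ d * 4 * ∏ ℓ ∈ P, C ℓ ^ 2 ^ min j' (e ℓ) < 2 ^ (2 ^ j' - 2 ^ j + a)) :
    MainConjectureLowerDivisibilityAtTwoOrd W :=
  katoHalfAt_two_of_layerSelmer_cert_gap_univ W h17
    lemma33_localTowerKerPrimary_cyclic_of_multiplicative_holds hS34 hper₀ hgo htors hjj' P hP hΔ C e k
    he hC hlow hup harith

/-- **The item `OrdKatoHalfAtTwo` AT `W` from ONE layer count, `h33g`, `hA` AND `hM` discharged** (as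
`katoHalfAt_two_of_layerSelmer_cert_upper_gap_univ`). [cite: Kato2004Asterisque, Thm. 17.4 (1)(2) (p. 273)]
[cite: GreenbergLNM1716, §3 Lemmas 3.1, 3.3–3.5, Prop. 2.5] -/
theorem katoHalfAt_two_of_layerSelmer_cert_upper_gap_univM
    (h17 : ∀ [NeZero (W.conductorNorm ℤ)] (f : CuspForm (Gamma0 (W.conductorNorm ℤ)) 2),
      kato_divisibility_allPrimes W 2 (f := f))
    (hS34 : lemma34_localTowerKerPrimary_cyclicExtension_rat)
    (hper₀ : ∀ [NeZero (W.conductorNorm ℤ)] (f : CuspForm (Gamma0 (W.conductorNorm ℤ)) 2),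
      IsNewformOf W f → ∀ ϖ : ℚ, (ϖ : ℝ) * W.realPeriodRat = plusPeriod f → 0 ≤ padicValRat 2 ϖ)
    (hgo : GoodOrd W 2) (htors : ¬ 2 ∣ W.torsionOrder) {j' d : ℕ}
    (P : Finset ℕ) (hP : ∀ ℓ ∈ P, ℓ.Prime ∧ ℓ ≠ 2)
    (hΔ : ∀ ℓ : ℕ, ℓ.Prime → ℓ ≠ 2 → (ℓ : ℤ) ∣ W.minimalDiscriminantInt → ℓ ∈ P)
    (C e k : ℕ → ℕ) (he : ∀ ℓ ∈ P, ¬ 2 ^ (e ℓ + 4) ∣ ℓ ^ 2 - 1)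
    (hC : ∀ (ℓ : ℕ) [Fact ℓ.Prime], ℓ ∈ P →
      4 ≤ C ℓ ∨ (W.HasMultiplicativeReductionAtPrime ℓ ∧ 2 ≤ C ℓ) ∨
        (W.HasMultiplicativeReductionAtPrime ℓ ∧ (ℓ : ℤ) ^ k ℓ ∣ W.minimalDiscriminantInt ∧
          ¬ (ℓ : ℤ) ^ (k ℓ + 1) ∣ W.minimalDiscriminantInt ∧ ¬ 2 ∣ k ℓ ∧ 1 ≤ C ℓ) ∨
        (¬ (ℓ : ℤ) ∣ W.minimalDiscriminantInt ∧ 1 ≤ C ℓ))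
    (hup : ∀ κ : ZpExtension ℚ 2, κ.IsCyclotomic →
      Nat.card {z : W.selmerLayer κ j' // 2 • z = 0} ≤ 2 ^ d)
    (harith : 2 ^ d * 4 * ∏ ℓ ∈ P, C ℓ ^ 2 ^ min j' (e ℓ) < 2 ^ (2 ^ j' - 1)) :
    MainConjectureLowerDivisibilityAtTwoOrd W :=
  katoHalfAt_two_of_layerSelmer_cert_upper_gap_univ W h17
    lemma33_localTowerKerPrimary_cyclic_of_multiplicative_holds hS34 hper₀ hgo htors P hP hΔ C e k he
    hC hup harith

/-- **Door (`Ш`-currency, decidable certificates) for `BSD(E,2)` at analytic rank `0`, `h33g`, `hA`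
AND `hM` discharged.** PRINT: `hmod`, `hGZK`, `h17`, `hEC`, `hS34`; CERTIFICATES as in
`bsdp_two_of_layerSelmer_cert_of_missingLowerBoundAt`.
[cite: GreenbergLNM1716, Thm. 4.1 (p. 102), §3 Lemmas 3.3–3.5, Prop. 2.5] [cite: Kato2004Asterisque, Thm. 17.4 (1)(2) (p. 273)]
[cite: Miller2011LMS, Def. 1.1] -/
theorem bsdp_two_of_layerSelmer_cert_univM_of_missingLowerBoundAt
    (hmod : nonempty_modularParametrizationData) (hGZK : rank_eq_analyticRank_of_analyticRank_le_one)
    (h17 : ∀ [NeZero (W.conductorNorm ℤ)] (f : CuspForm (Gamma0 (W.conductorNorm ℤ)) 2),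
      kato_divisibility_allPrimes W 2 (f := f))
    (hEC : TwoAdicEulerCharRankZero W 0)
    (hS34 : lemma34_localTowerKerPrimary_cyclicExtension_rat)
    (hper₀ : ∀ [NeZero (W.conductorNorm ℤ)] (f : CuspForm (Gamma0 (W.conductorNorm ℤ)) 2),
      IsNewformOf W f → ∀ ϖ : ℚ, (ϖ : ℝ) * W.realPeriodRat = plusPeriod f → 0 ≤ padicValRat 2 ϖ)
    (hgo : GoodOrd W 2) (hr : W.analyticRank = 0) (htors : ¬ 2 ∣ W.torsionOrder) {j j' a d : ℕ}
    (hjj' : j ≤ j') (P : Finset ℕ) (hP : ∀ ℓ ∈ P, ℓ.Prime ∧ ℓ ≠ 2)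
    (hΔ : ∀ ℓ : ℕ, ℓ.Prime → ℓ ≠ 2 → (ℓ : ℤ) ∣ W.minimalDiscriminantInt → ℓ ∈ P)
    (C e k : ℕ → ℕ) (he : ∀ ℓ ∈ P, ¬ 2 ^ (e ℓ + 4) ∣ ℓ ^ 2 - 1)
    (hC : ∀ (ℓ : ℕ) [Fact ℓ.Prime], ℓ ∈ P →
      4 ≤ C ℓ ∨ (W.HasMultiplicativeReductionAtPrime ℓ ∧ 2 ≤ C ℓ) ∨
        (W.HasMultiplicativeReductionAtPrime ℓ ∧ (ℓ : ℤ) ^ k ℓ ∣ W.minimalDiscriminantInt ∧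
          ¬ (ℓ : ℤ) ^ (k ℓ + 1) ∣ W.minimalDiscriminantInt ∧ ¬ 2 ∣ k ℓ ∧ 1 ≤ C ℓ) ∨
        (¬ (ℓ : ℤ) ∣ W.minimalDiscriminantInt ∧ 1 ≤ C ℓ))
    (hlow : ∀ κ : ZpExtension ℚ 2, κ.IsCyclotomic →
      2 ^ a ≤ Nat.card {z : W.selmerLayer κ j // 2 • z = 0})
    (hup : ∀ κ : ZpExtension ℚ 2, κ.IsCyclotomic →
      Nat.card {z : W.selmerLayer κ j' // 2 • z = 0} ≤ 2 ^ d)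
    (harith : 2 ^ d * 4 * ∏ ℓ ∈ P, C ℓ ^ 2 ^ min j' (e ℓ) < 2 ^ (2 ^ j' - 2 ^ j + a))
    (hsha : MissingLowerBoundAt W 2) : BSDp W 2 :=
  bsdp_two_of_layerSelmer_cert_univ_of_missingLowerBoundAt W hmod hGZK h17 hEC
    lemma33_localTowerKerPrimary_cyclic_of_multiplicative_holds hS34 hper₀ hgo hr htors hjj' P hP hΔ C
    e k he hC hlow hup harith hsha

/-- **Door (`Ш`-currency, decidable certificates): `MazurMainConjecture W 2` at analytic rank `0`,
`h33g`, `hA` AND `hM` discharged** (as `mazurMainConjecture_two_of_layerSelmer_cert_univ_of_missingLowerBoundAt`).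
[cite: Kato2004Asterisque, Thm. 17.4 (1)(2) (p. 273)] [cite: GreenbergLNM1716, Thm. 4.1 (p. 102), §3 Lemmas 3.3–3.5, Prop. 2.5] -/
theorem mazurMainConjecture_two_of_layerSelmer_cert_univM_of_missingLowerBoundAt
    (hmod : nonempty_modularParametrizationData) (hGZK : rank_eq_analyticRank_of_analyticRank_le_one)
    (h17 : ∀ [NeZero (W.conductorNorm ℤ)] (f : CuspForm (Gamma0 (W.conductorNorm ℤ)) 2),
      kato_divisibility_allPrimes W 2 (f := f))
    (hEC : TwoAdicEulerCharRankZero W 0)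
    (hS34 : lemma34_localTowerKerPrimary_cyclicExtension_rat)
    (hper₀ : ∀ [NeZero (W.conductorNorm ℤ)] (f : CuspForm (Gamma0 (W.conductorNorm ℤ)) 2),
      IsNewformOf W f → ∀ ϖ : ℚ, (ϖ : ℝ) * W.realPeriodRat = plusPeriod f → 0 ≤ padicValRat 2 ϖ)
    (hgo : GoodOrd W 2) (hr : W.analyticRank = 0) (htors : ¬ 2 ∣ W.torsionOrder) {j j' a d : ℕ}
    (hjj' : j ≤ j') (P : Finset ℕ) (hP : ∀ ℓ ∈ P, ℓ.Prime ∧ ℓ ≠ 2)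
    (hΔ : ∀ ℓ : ℕ, ℓ.Prime → ℓ ≠ 2 → (ℓ : ℤ) ∣ W.minimalDiscriminantInt → ℓ ∈ P)
    (C e k : ℕ → ℕ) (he : ∀ ℓ ∈ P, ¬ 2 ^ (e ℓ + 4) ∣ ℓ ^ 2 - 1)
    (hC : ∀ (ℓ : ℕ) [Fact ℓ.Prime], ℓ ∈ P →
      4 ≤ C ℓ ∨ (W.HasMultiplicativeReductionAtPrime ℓ ∧ 2 ≤ C ℓ) ∨
        (W.HasMultiplicativeReductionAtPrime ℓ ∧ (ℓ : ℤ) ^ k ℓ ∣ W.minimalDiscriminantInt ∧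
          ¬ (ℓ : ℤ) ^ (k ℓ + 1) ∣ W.minimalDiscriminantInt ∧ ¬ 2 ∣ k ℓ ∧ 1 ≤ C ℓ) ∨
        (¬ (ℓ : ℤ) ∣ W.minimalDiscriminantInt ∧ 1 ≤ C ℓ))
    (hlow : ∀ κ : ZpExtension ℚ 2, κ.IsCyclotomic →
      2 ^ a ≤ Nat.card {z : W.selmerLayer κ j // 2 • z = 0})
    (hup : ∀ κ : ZpExtension ℚ 2, κ.IsCyclotomic →
      Nat.card {z : W.selmerLayer κ j' // 2 • z = 0} ≤ 2 ^ d)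
    (harith : 2 ^ d * 4 * ∏ ℓ ∈ P, C ℓ ^ 2 ^ min j' (e ℓ) < 2 ^ (2 ^ j' - 2 ^ j + a))
    (hsha : MissingLowerBoundAt W 2) : MazurMainConjecture W 2 :=
  mazurMainConjecture_two_of_layerSelmer_cert_univ_of_missingLowerBoundAt W hmod hGZK h17 hEC
    lemma33_localTowerKerPrimary_cyclic_of_multiplicative_holds hS34 hper₀ hgo hr htors hjj' P hP hΔ C
    e k he hC hlow hup harith hsha

end Curve

end Summit.BirchSwinnertonDyer.BirchSwinnertonDyer.Theorems.KatoHalfPinch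

end
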